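import Mathlib
import HarnessLib

/-!
# Rank-one (dyadic) updates against a positive diagonal pencil: Cauchy–Schwarz bounds

HONEST FRAMING (page 1, pub-hubbard ladder R1–R4 with certified numbers; no claim on H/H₀ — this is a
pure linear-algebra support file).

For a positive diagonal weight `G = diagonal g` (`g > 0`), a vector `c` and `x`,
`x ⬝ (c cᵀ) x = (c ⬝ x)² ≤ (Σ_a c_a²/g_a) · (x ⬝ G x)` (Cauchy–Schwarz in the `G`-weighted inner
product), hence for `t ≥ 0`
`Σ_j t_j c_j c_jᵀ ⪯ (Σ_j t_j Σ_a c_{j,a}²/g_a) · G`.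
Consequently, if `c₀ G ⪯ A ⪯ c_max G` then the rank-`k` modified matrix `A' = A + Σ_j t_j c_j c_jᵀ`
satisfies `c₀ G ⪯ A' ⪯ (c_max + Σ_j t_j Σ_a c_{j,a}²/g_a) G`.  This is the bookkeeping that keeps the
spectral interval `[c₀, c_max']` of the pencil `(A', G)` explicit after the deflation vectors of a
Schur/pencil certificate (`SchurComplementPencilBound`, `SchurComplementResidualBound`) are absorbed into
the free block (the "Route 2" design of the pub-hubbard E-D-2″ certificate: no eigenvector enclosure).
References: Horn–Johnson, *Matrix Analysis* (2nd ed.): the Cauchy–Schwarz inequality [HornJohnson2013,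
Thm 5.1.4], dyads and sums of positive semidefinite matrices [HornJohnson2013, Obs. 7.1.8], the Loewner
order under sums/congruence [HornJohnson2013, Thm 7.7.3]; Golub–Van Loan [GolubVanLoan2013, §8.7]
(symmetric-definite pencils).
-/

namespace Literature.Analysis.OperatorTheory

open Matrix Finset
open scoped BigOperators

variable {m : Type*} [Fintype m] [DecidableEq m]

omit [DecidableEq m] in
/-- `x ⬝ (c cᵀ) x = (c ⬝ x)²`. [cite: HornJohnson2013, Obs. 7.1.8] -/
theorem dotProduct_vecMulVec_mulVec_self (c x : m → ℝ) :
    x ⬝ᵥ (vecMulVec c c *ᵥ x) = (c ⬝ᵥ x) ^ 2 := by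
  have h : vecMulVec c c *ᵥ x = (c ⬝ᵥ x) • c := by
    rw [vecMulVec_mulVec]
    ext i
    simp [mul_comm]
  rw [h, dotProduct_smul, smul_eq_mul, dotProduct_comm x c, sq]

/-- `x ⬝ (diagonal g) x = Σ_a g_a x_a²`. [cite: HornJohnson2013, §0.9.1] -/
theorem dotProduct_diagonal_mulVec_self (g x : m → ℝ) :
    x ⬝ᵥ (diagonal g *ᵥ x) = ∑ a, g a * x a ^ 2 := by
  simp only [mulVec_diagonal, dotProduct]
  exact Finset.sum_congr rfl fun a _ => by ring

/-- **Weighted Cauchy–Schwarz for a dyad against a positive diagonal**: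
`x ⬝ (c cᵀ) x ≤ (Σ_a c_a²/g_a) · (x ⬝ diagonal g x)`. [cite: HornJohnson2013, Thm 5.1.4] -/
theorem dotProduct_vecMulVec_le_diagonal (c g : m → ℝ) (hg : ∀ a, 0 < g a) (x : m → ℝ) :
    x ⬝ᵥ (vecMulVec c c *ᵥ x) ≤ (∑ a, c a ^ 2 / g a) * (x ⬝ᵥ (diagonal g *ᵥ x)) := by
  rw [dotProduct_vecMulVec_mulVec_self, dotProduct_diagonal_mulVec_self]
  -- Cauchy–Schwarz / Sedrakyan: (Σ c x)² ≤ (Σ c²/g)(Σ g x²) since (c x)² = (c²/g)(g x²)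
  refine Finset.sum_sq_le_sum_mul_sum_of_sq_le_mul Finset.univ (r := fun a => c a * x a)
    (fun a _ => div_nonneg (sq_nonneg _) (le_of_lt (hg a)))
    (fun a _ => mul_nonneg (le_of_lt (hg a)) (sq_nonneg _)) fun a _ => le_of_eq ?_
  have hga : g a ≠ 0 := (hg a).ne'
  field_simp

/-- **Rank-`k` version**: for `t ≥ 0`,
`x ⬝ (Σ_j t_j c_j c_jᵀ) x ≤ (Σ_j t_j Σ_a c_{j,a}²/g_a) · (x ⬝ diagonal g x)`.
[cite: HornJohnson2013, Thm 7.7.3] -/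
theorem dotProduct_sum_smul_vecMulVec_le_diagonal {k : ℕ} (t : Fin k → ℝ) (ht : ∀ j, 0 ≤ t j)
    (c : Fin k → m → ℝ) (g : m → ℝ) (hg : ∀ a, 0 < g a) (x : m → ℝ) :
    x ⬝ᵥ ((∑ j, t j • vecMulVec (c j) (c j)) *ᵥ x) ≤
      (∑ j, t j * ∑ a, c j a ^ 2 / g a) * (x ⬝ᵥ (diagonal g *ᵥ x)) := by
  rw [sum_mulVec, dotProduct_sum, Finset.sum_mul]
  refine Finset.sum_le_sum fun j _ => ?_
  rw [smul_mulVec, dotProduct_smul, smul_eq_mul, mul_assoc]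
  exact mul_le_mul_of_nonneg_left (dotProduct_vecMulVec_le_diagonal (c j) g hg x) (ht j)

omit [Fintype m] [DecidableEq m] in
/-- A dyad sum with real weights is symmetric. [cite: HornJohnson2013, Obs. 7.1.8] -/
theorem isHermitian_sum_smul_vecMulVec {k : ℕ} (t : Fin k → ℝ) (c : Fin k → m → ℝ) :
    (∑ j, t j • vecMulVec (c j) (c j)).IsHermitian := by
  unfold Matrix.IsHermitian
  rw [conjTranspose_sum]
  refine Finset.sum_congr rfl fun j _ => ?_
  rw [conjTranspose_smul, star_trivial]
  congr 1
  ext a b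
  simp [vecMulVec_apply, mul_comm]

omit [DecidableEq m] in
/-- **Lower pencil bound survives a nonnegative dyadic update**:
`c₀ G ⪯ A` and `t ≥ 0` give `c₀ G ⪯ A + Σ_j t_j c_j c_jᵀ`. [cite: HornJohnson2013, Thm 7.7.3] -/
theorem posSemidef_add_sum_vecMulVec_sub_smul {k : ℕ} (A G : Matrix m m ℝ) (c₀ : ℝ)
    (hAc : (A - c₀ • G).PosSemidef) (t : Fin k → ℝ) (ht : ∀ j, 0 ≤ t j) (c : Fin k → m → ℝ) :
    (A + ∑ j, t j • vecMulVec (c j) (c j) - c₀ • G).PosSemidef := by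
  have hH : (A + ∑ j, t j • vecMulVec (c j) (c j) - c₀ • G).IsHermitian := by
    have e : A + ∑ j, t j • vecMulVec (c j) (c j) - c₀ • G =
        (A - c₀ • G) + ∑ j, t j • vecMulVec (c j) (c j) := by abel
    rw [e]
    exact hAc.isHermitian.add (isHermitian_sum_smul_vecMulVec t c)
  refine Matrix.PosSemidef.of_dotProduct_mulVec_nonneg hH fun x => ?_
  have h0 := hAc.dotProduct_mulVec_nonneg x
  rw [star_trivial] at h0 ⊢
  have hdy : 0 ≤ x ⬝ᵥ ((∑ j, t j • vecMulVec (c j) (c j)) *ᵥ x) := by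
    rw [sum_mulVec, dotProduct_sum]
    refine Finset.sum_nonneg fun j _ => ?_
    rw [smul_mulVec, dotProduct_smul, smul_eq_mul, dotProduct_vecMulVec_mulVec_self]
    exact mul_nonneg (ht j) (sq_nonneg _)
  have e : x ⬝ᵥ ((A + ∑ j, t j • vecMulVec (c j) (c j) - c₀ • G) *ᵥ x) =
      x ⬝ᵥ ((A - c₀ • G) *ᵥ x) + x ⬝ᵥ ((∑ j, t j • vecMulVec (c j) (c j)) *ᵥ x) := by
    simp only [add_mulVec, sub_mulVec, dotProduct_add, dotProduct_sub]
    ring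
  rw [e]
  exact add_nonneg h0 hdy

/-- **Upper pencil bound after a nonnegative dyadic update (explicit constant)**:
`A ⪯ c_max · diagonal g`, `g > 0`, `t ≥ 0` give
`A + Σ_j t_j c_j c_jᵀ ⪯ (c_max + Σ_j t_j Σ_a c_{j,a}²/g_a) · diagonal g`. [cite: HornJohnson2013, Thm 7.7.3] -/
theorem posSemidef_smul_diagonal_sub_add_sum_vecMulVec {k : ℕ} (A : Matrix m m ℝ) (g : m → ℝ)
    (hg : ∀ a, 0 < g a) (cmax : ℝ) (hAcmax : (cmax • diagonal g - A).PosSemidef) (t : Fin k → ℝ)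
    (ht : ∀ j, 0 ≤ t j) (c : Fin k → m → ℝ) :
    ((cmax + ∑ j, t j * ∑ a, c j a ^ 2 / g a) • diagonal g -
        (A + ∑ j, t j • vecMulVec (c j) (c j))).PosSemidef := by
  have hGd : (diagonal g : Matrix m m ℝ).IsHermitian := isHermitian_diagonal g
  have hA : A.IsHermitian := by
    have h := hAcmax.isHermitian
    have e : A = cmax • diagonal g - (cmax • diagonal g - A) := by abel
    rw [e]
    exact (hGd.smul (IsSelfAdjoint.all cmax)).sub h
  have hH : ((cmax + ∑ j, t j * ∑ a, c j a ^ 2 / g a) • diagonal g -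
      (A + ∑ j, t j • vecMulVec (c j) (c j))).IsHermitian :=
    (hGd.smul (IsSelfAdjoint.all _)).sub (hA.add (isHermitian_sum_smul_vecMulVec t c))
  refine Matrix.PosSemidef.of_dotProduct_mulVec_nonneg hH fun x => ?_
  have h0 := hAcmax.dotProduct_mulVec_nonneg x
  rw [star_trivial] at h0 ⊢
  rw [sub_mulVec, dotProduct_sub, smul_mulVec, dotProduct_smul, smul_eq_mul] at h0
  have hdy := dotProduct_sum_smul_vecMulVec_le_diagonal t ht c g hg x
  rw [sub_mulVec, dotProduct_sub, smul_mulVec, dotProduct_smul, smul_eq_mul, add_mulVec,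
    dotProduct_add, add_mul]
  linarith

end Literature.Analysis.OperatorTheory
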